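import Mathlib
import Summits.Ventures.PercRepro2.Defs
import Summits.Ventures.PercRepro2.Graph
import Summits.Ventures.PercRepro2.Induced
import Summits.Ventures.PercRepro2.VdBKahn
import Summits.Ventures.PercRepro2.ReimerVdBK
import Summits.Ventures.PercRepro2.ReimerVdBKTwisted
import Summits.Ventures.PercRepro2.ReimerVdBKTied
import Summits.Ventures.PercRepro2.ReimerVdBKCoreDown
import Summits.Ventures.PercRepro2.ReimerVdBKDegTwoCalc
import Summits.Ventures.PercRepro2.ReimerVdBKOuter
import Summits.Ventures.PercRepro2.ReimerVdBKPatch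
import Summits.Ventures.PercRepro2.ReimerVdBKOuterStars

/-!
# Edges at a vertex set, monotonicity off loops and the closure lemma in outer-star form
(blind cell PercRepro2, mine-c g50; `conjectures/MINE-C.md` §59.0, `proofs/MINEC-CELL.md` — part I of the
cell theorem; part II `ReimerVdBKCell`, part III `ReimerVdBKCellCoin`)

`edgesTouching ends W` = all edges incident to a vertex of `W` (outer stars and inner edges alike); a CELL
of a revealed set `R` is the sub-cube `onF (edgesTouching ends R) d` of a pattern `d` on these edges.
`conn_mono_offLoops`: connection is monotone in the configuration restricted to the non-loop edges (the
open subgraph never uses a loop).  `conn_iff_of_closed_outer`: the closure lemma of `ReimerVdBKPatch` with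
agreement required only on the edges joining a closed vertex to a vertex OUTSIDE the closed set — inner
edges between closed vertices may differ, which is what lets the target cell of the cell theorem carry any
inner colouring.  `patch_setOn_le` / `patch_compl_setOn_le` / `patch_setOn_agree` / `patch_compl_setOn_agree`:
closing the edges at a vertex set on a pattern, in world 1 or in world 2, as in `ReimerVdBKOuterStars`.
-/
namespace Summit.Ventures.PercRepro2
namespace ReimerVdBK
open Classical

variable {V : Type*} {E : Type*} [Fintype E] [DecidableEq E] [Fintype V] [DecidableEq V]

/-! ## Monotonicity off loops and the closure lemma in outer-star form -/

section Graph
variable (ends : E → Sym2 V) (s : V)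

omit [Fintype E] [DecidableEq E] [Fintype V] [DecidableEq V] in
/-- The open subgraph is monotone in the configuration restricted to the non-loop edges. -/
lemma openGraph_mono_offLoops {ω ω' : Config E} (h : ∀ e, ¬ (ends e).IsDiag → ω e ≤ ω' e) :
    openGraph ends ω ≤ openGraph ends ω' := by
  intro u v huv
  rw [openGraph_adj] at huv ⊢
  obtain ⟨hne, e, he, hends⟩ := huv
  refine ⟨hne, e, ?_, hends⟩
  have hnd : ¬ (ends e).IsDiag := by
    rw [hends, Sym2.mk_isDiag_iff]
    exact hne
  have := h e hnd
  rw [he] at this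
  exact Bool.le_iff_imp.1 this rfl

omit [Fintype E] [DecidableEq E] [Fintype V] [DecidableEq V] in
/-- Connection is monotone in the configuration restricted to the non-loop edges. -/
lemma conn_mono_offLoops {ω ω' : Config E} (h : ∀ e, ¬ (ends e).IsDiag → ω e ≤ ω' e) {u v : V}
    (hc : Conn ends ω u v) : Conn ends ω' u v :=
  SimpleGraph.Reachable.mono (openGraph_mono_offLoops ends h) hc

omit [Fintype E] [DecidableEq E] [Fintype V] [DecidableEq V] in
/-- **Closure lemma, outer-star form.**  Let `η₀ ≤ η` agree on every edge not incident to the vertex set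
`W`, and suppose that every `w ∈ W` is outside the cluster of `s` in some configuration `η_w ≥ η₀` that
agrees with `η` on the edges joining `w` to a vertex OUTSIDE `W`.  Then the cluster of `s` in `η` is its
cluster in `η₀`.  (`conn_iff_of_closed_stars` of `ReimerVdBKPatch` asks for agreement on the whole star.) -/
lemma conn_iff_of_closed_outer {η η₀ : Config E} (W : Finset V) (hle : η₀ ≤ η)
    (hoff : ∀ e, (∀ w ∈ W, w ∉ ends e) → η₀ e = η e)
    (hW : ∀ w ∈ W, ∃ ηw : Config E, η₀ ≤ ηw ∧
      (∀ e, w ∈ ends e → (∃ x ∈ ends e, x ∉ W) → ηw e = η e) ∧ ¬ Conn ends ηw s w)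
    (u : V) : Conn ends η s u ↔ Conn ends η₀ s u := by
  refine ⟨fun h => ?_, conn_mono hle⟩
  refine mem_of_conn_of_closed (ends := ends) (ω := η) (S := {x | Conn ends η₀ s x}) ?_
    (conn_refl ends η₀ s) h
  intro x hx y hxy
  obtain ⟨_, e, he, hends⟩ := openGraph_adj.1 hxy
  simp only [Set.mem_setOf_eq] at hx ⊢
  by_cases hxW : x ∈ W
  · obtain ⟨ηx, hle', _, hnc⟩ := hW x hxW
    exact absurd (conn_mono hle' hx) hnc
  by_cases hW' : ∃ w ∈ W, w ∈ ends e
  · obtain ⟨w, hwW, hwe⟩ := hW'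
    obtain ⟨ηw, hle', hagree, hnc⟩ := hW w hwW
    have hwe' : w = x ∨ w = y := by
      rw [hends] at hwe
      exact Sym2.mem_iff.1 hwe
    have hxe : x ∈ ends e := by rw [hends]; exact Sym2.mem_mk_left x y
    have hxw : Conn ends ηw s x := conn_mono hle' hx
    have hew : ηw e = true := by rw [hagree e hwe ⟨x, hxe, hxW⟩]; exact he
    exfalso
    rcases hwe' with rfl | rfl
    · exact hxW hwW
    · exact hnc (conn_trans hxw (conn_of_openAdj ⟨e, hew, hends⟩))
  · have h0 : η₀ e = true := by
      rw [hoff e (fun w hw hwe => hW' ⟨w, hw, hwe⟩)]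
      exact he
    exact conn_trans hx (conn_of_openAdj ⟨e, h0, hends⟩)

end Graph

/-! ## The edges at a vertex set; cells -/

section EdgesAt
variable (ends : E → Sym2 V)

/-- The edges incident to a vertex of `W` (outer stars and inner edges alike). -/
def edgesTouching (W : Finset V) : Finset E := Finset.univ.filter fun e => ∃ w ∈ W, w ∈ ends e

omit [DecidableEq E] [Fintype V] in
/-- Membership in `edgesTouching`. -/
lemma mem_edgesAt_iff {W : Finset V} {e : E} : e ∈ edgesTouching ends W ↔ ∃ w ∈ W, w ∈ ends e := by
  simp [edgesTouching]

omit [DecidableEq E] [Fintype V] in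
/-- `edgesTouching` is monotone. -/
lemma edgesAt_mono {W W' : Finset V} (h : W ⊆ W') : edgesTouching ends W ⊆ edgesTouching ends W' := by
  intro e he
  obtain ⟨w, hw, hwe⟩ := (mem_edgesAt_iff ends).1 he
  exact (mem_edgesAt_iff ends).2 ⟨w, h hw, hwe⟩

omit [DecidableEq E] [Fintype V] in
/-- An edge incident to no vertex of `W` is not an edge at `W`. -/
lemma not_mem_edgesAt_of_not_incident {W : Finset V} {e : E} (h : ∀ w ∈ W, w ∉ ends e) :
    e ∉ edgesTouching ends W := by
  intro he
  obtain ⟨w, hw, hwe⟩ := (mem_edgesAt_iff ends).1 he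
  exact h w hw hwe

omit [DecidableEq E] [Fintype V] in
/-- An edge at `W` is incident to some vertex of `W`. -/
lemma exists_mem_of_mem_edgesAt {W : Finset V} {e : E} (he : e ∈ edgesTouching ends W) : ∃ w ∈ W, w ∈ ends e :=
  (mem_edgesAt_iff ends).1 he

omit [DecidableEq E] in
/-- The outer star of a revealed vertex consists of edges at `R`. -/
lemma outerStar_subset_edgesAt {R : Finset V} {w : V} (hw : w ∈ R) : outerStar ends R w ⊆ edgesTouching ends R :=
  fun _ he => (mem_edgesAt_iff ends).2 ⟨w, hw, mem_ends_of_mem_outerStar ends he⟩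

/-- The outer edges of `R` are edges at `R`. -/
lemma FE_subset_edgesAt (R : Finset V) : FE ends R ⊆ edgesTouching ends R := by
  intro e he
  obtain ⟨v, hv, hve⟩ := (mem_outerEdges_iff ends R).1 he
  exact outerStar_subset_edgesAt ends hv hve

omit [DecidableEq E] in
/-- An outer-star edge of `w ∈ R` joins `w` to a vertex outside `R`. -/
lemma exists_not_mem_of_mem_outerStar {R : Finset V} {w : V} {e : E} (he : e ∈ outerStar ends R w) :
    ∃ x ∈ ends e, x ∉ R := by
  obtain ⟨x, hx, hxR⟩ := (mem_outerStar_iff ends).1 he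
  exact ⟨x, by rw [hx]; exact Sym2.mem_mk_right w x, hxR⟩

end EdgesAt

/-! ## Patched configurations with the edges at a forced set closed -/

section Patched
variable (ends : E → Sym2 V) (R : Finset V)

omit [Fintype V] in
/-- Closing the edges at a set `W` on a pattern gives a smaller patched configuration. -/
lemma patch_setOn_le (W : Finset V) (d : Config E) (ω' : Config {e : E // e ∉ edgesTouching ends R}) :
    patch (edgesTouching ends R) (setOn (edgesTouching ends W) false d) ω' ≤ patch (edgesTouching ends R) d ω' := by
  refine patch_le_patch _ (fun e _ => ?_) ω'
  by_cases he : e ∈ edgesTouching ends W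
  · rw [setOn_of_mem _ he]
    exact Bool.false_le _
  · rw [setOn_of_not_mem _ he]

omit [Fintype V] in
/-- Closing the edges at `W` in world 2 gives a smaller world-2 configuration. -/
lemma patch_compl_setOn_le (W : Finset V) (d : Config E) (ω' : Config {e : E // e ∉ edgesTouching ends R}) :
    patch (edgesTouching ends R) (compl (setOn (edgesTouching ends W) true d)) ω' ≤
      patch (edgesTouching ends R) (compl d) ω' := by
  refine patch_le_patch _ (fun e _ => ?_) ω'
  rw [compl_setOn]
  by_cases he : e ∈ edgesTouching ends W
  · rw [setOn_of_mem _ he]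
    exact Bool.false_le _
  · rw [setOn_of_not_mem _ he]

omit [Fintype V] in
/-- The two configurations of `patch_setOn_le` agree off the edges at `W`. -/
lemma patch_setOn_agree (W : Finset V) (d : Config E) (ω' : Config {e : E // e ∉ edgesTouching ends R}) (e : E)
    (h : ∀ w ∈ W, w ∉ ends e) :
    patch (edgesTouching ends R) (setOn (edgesTouching ends W) false d) ω' e = patch (edgesTouching ends R) d ω' e := by
  have he : e ∉ edgesTouching ends W := not_mem_edgesAt_of_not_incident ends h
  by_cases hF : e ∈ edgesTouching ends R
  · rw [patch_of_mem _ hF, patch_of_mem _ hF, setOn_of_not_mem _ he]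
  · rw [patch_of_not_mem _ hF, patch_of_not_mem _ hF]

omit [Fintype V] in
/-- The two configurations of `patch_compl_setOn_le` agree off the edges at `W`. -/
lemma patch_compl_setOn_agree (W : Finset V) (d : Config E) (ω' : Config {e : E // e ∉ edgesTouching ends R})
    (e : E) (h : ∀ w ∈ W, w ∉ ends e) :
    patch (edgesTouching ends R) (compl (setOn (edgesTouching ends W) true d)) ω' e =
      patch (edgesTouching ends R) (compl d) ω' e := by
  have he : e ∉ edgesTouching ends W := not_mem_edgesAt_of_not_incident ends h
  by_cases hF : e ∈ edgesTouching ends R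
  · rw [patch_of_mem _ hF, patch_of_mem _ hF, compl_setOn, setOn_of_not_mem _ he]
  · rw [patch_of_not_mem _ hF, patch_of_not_mem _ hF]

end Patched

end ReimerVdBK
end Summit.Ventures.PercRepro2
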